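import Mathlib.Algebra.MvPolynomial.PDeriv
import Mathlib.Algebra.MvPolynomial.Variables
import Mathlib.RingTheory.MvPolynomial.Basic
import Mathlib.RingTheory.MvPolynomial.Homogeneous
import Literature.Barriers.ValiantsHypothesis.PartialDerivativesDetPerm
import Literature.Computability.AlgebraicComplexity.LinSubst
import HarnessLib

/-!
# Shifted partial derivatives: degenerations of the determinant — generic lemmas

Support file for the barrier entry `ShiftedPartialDerivatives.lean` (Efremenko–Landsberg–Schenck–
Weyman 2018, Thm. 1.5, `ShiftedPartialsCannotSeparate`), Cases C1 and C3 of whose proof compare the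
padded permanent with DEGENERATIONS `R ∈ End(W)·det_n` obtained by specialising the entries of the
generic matrix to variables or to zero (§3: "Block the matrix ... Set each diagonal block to the
matrix `(y^i_j)` ... fill the remainder of the diagonal with `ℓ` ... and fill the remainder of the
matrix with zeros. Let `R` be the restriction of the determinant to this subspace"; §5:
"degenerate `det_n` to `R = ℓ₁ⁿ + ℓ₂ⁿ` by e.g., setting all diagonal elements to `ℓ₁`, all the
sub-diagonal elements to `ℓ₂` as well as the `(1,n)`-entry, and setting all other elements of the
matrix to zero"), and then compute iterated partial derivatives of `R` (§3, Example 3.1: "The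
polynomial `(y¹₁)²` is the image of `∂⁴/∂x²₂∂x⁴₄∂x⁵₅∂x⁶₆`"). This file proves the generic,
definition-free lemmas such computations need; the Case C1 construction itself is
`ShiftedPartialsCaseC1.lean`.

* Substitutions by variables-or-zero `X a ↦ (d a).elim 0 X` for `d : α → Option σ` (Mathlib's
  `aeval`): composition (`aeval_option_aeval_option`), they are `linSubst` by a `0/1` matrix and
  hence land in `endOrbit` (`aeval_option_eq_linSubst`, `aeval_option_mem_endOrbit`), and the
  CHAIN RULE for a variable with a unique preimage (`pderiv_aeval_option_of_unique`,
  `iterPDeriv_aeval_option`); iterated derivatives commute with injective renamings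
  (`iterPDeriv_rename`, from Mathlib's `pderiv_rename`).
* LEIBNIZ for products of polynomials in pairwise disjoint sets of variables, the derivative list
  being a concatenation of per-factor lists (`iterPDeriv_list_prod`; `vars_pderiv_subset`,
  `iterPDeriv_mul_left/right`).
* The derivative of the generic `c × c` determinant along the `c - 1` cells `(π₀ b, b)`, `b ≠ b₀`,
  of a transversal is `sign π₀ · X (π₀ b₀, b₀)` (`iterPDeriv_rook_detPoly`, from the tree's
  `iterPDeriv_permSum`), and TRIDIAGONAL MATCHINGS: for any two indices `i, j` there is a
  permutation `π` with `π j = i` whose other cells `(π b, b)` are all on the three central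
  diagonals (`exists_tridiagonal_matching`: shift the interval between `i` and `j` by one).
* Forms: derivatives of forms are forms (`isHomogeneous_pderiv`, `isHomogeneous_iterPDeriv`), the
  support of `x^β · w` for a form `w` in variables `Z` (`support_monomial_mul_subset`), the dimension
  of the polynomials supported on a finite set of monomials (`finrank_restrictSupport`, Mathlib's
  `basisRestrictSupport`), and a greedy choice of `s` variables of `Z` below a monomial of `Z`-degree
  `≥ s` (`exists_fun_sum_single_le`).

## References

* [EfremenkoLandsbergSchenckWeyman2018] K. Efremenko, J. M. Landsberg, H. Schenck, J. Weyman,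
  *The method of shifted partial derivatives cannot separate the permanent from the determinant*,
  Math. Comp. 87 (2018) 2037–2045, §3 (Case C1, Example 3.1), §5 (Case C3).
-/

noncomputable section

namespace Literature.Barriers.ValiantsHypothesis

open MvPolynomial Literature.Computability.AlgebraicComplexity

/-! ### Substitutions by variables-or-zero -/

section OptSubst

variable {K : Type*} [CommRing K] {α β σ : Type*}

/-- The substitution by variables-or-zero on a variable. [folklore] -/
theorem aeval_option_X (d : α → Option σ) (a : α) :
    aeval (fun a => ((d a).elim 0 X : MvPolynomial σ K)) (X a : MvPolynomial α K) = (d a).elim 0 X :=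
  aeval_X _ _

/-- Substitutions by variables-or-zero compose (Kleisli composition of the designs). [folklore] -/
theorem aeval_option_aeval_option (d : α → Option β) (d' : β → Option σ) (p : MvPolynomial α K) :
    aeval (fun b => ((d' b).elim 0 X : MvPolynomial σ K))
        (aeval (fun a => ((d a).elim 0 X : MvPolynomial β K)) p) =
      aeval (fun a => (((d a).bind d').elim 0 X : MvPolynomial σ K)) p := by
  have : (aeval (fun b => ((d' b).elim 0 X : MvPolynomial σ K))).comp
      (aeval (fun a => ((d a).elim 0 X : MvPolynomial β K))) =
      aeval fun a => (((d a).bind d').elim 0 X : MvPolynomial σ K) := by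
    refine MvPolynomial.algHom_ext fun a => ?_
    rw [AlgHom.comp_apply, aeval_X, aeval_X]
    cases d a with
    | none => simp
    | some b => simp
  rw [← AlgHom.comp_apply, this]

/-- A substitution by variables-or-zero of the same variable type is the tree's `linSubst` by the
`0/1` matrix of the design. [folklore] -/
theorem aeval_option_eq_linSubst [Fintype σ] [DecidableEq σ] (d : σ → Option σ) :
    aeval (fun a => ((d a).elim 0 X : MvPolynomial σ K)) =
      linSubst σ K (Matrix.of fun j i => if d i = some j then (1 : K) else 0) := by
  refine MvPolynomial.algHom_ext fun i => ?_
  rw [aeval_X, linSubst_X]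
  simp only [Matrix.of_apply, ite_smul, one_smul, zero_smul]
  cases h : d i with
  | none => simp
  | some j₀ =>
    simp only [Option.elim_some, Option.some.injEq]
    rw [Finset.sum_ite_eq]
    simp

/-- Hence every substitution by variables-or-zero of `f` lies in `End(K^σ) · f` — ELSW's
"restriction of the determinant to this subspace" is an element of `End(W) · det_n`.
[cite: EfremenkoLandsbergSchenckWeyman2018, §3] -/
theorem aeval_option_mem_endOrbit [Fintype σ] [DecidableEq σ] (d : σ → Option σ)
    (f : MvPolynomial σ K) : aeval (fun a => ((d a).elim 0 X : MvPolynomial σ K)) f ∈ endOrbit σ K f := by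
  rw [aeval_option_eq_linSubst]
  exact ⟨_, rfl⟩

variable [DecidableEq α] [DecidableEq σ]

/-- **Chain rule for a variable with a unique preimage**: if `X a` is the only variable sent to
`X v`, then `∂_v` of the substituted polynomial is the substitution of `∂_a`. [folklore] -/
theorem pderiv_aeval_option_of_unique (d : α → Option σ) {a : α} {v : σ} (ha : d a = some v)
    (huniq : ∀ a', d a' = some v → a' = a) (p : MvPolynomial α K) :
    pderiv v (aeval (fun a => ((d a).elim 0 X : MvPolynomial σ K)) p) =
      aeval (fun a => ((d a).elim 0 X : MvPolynomial σ K)) (pderiv a p) := by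
  induction p using MvPolynomial.induction_on with
  | C c => simp
  | add p q hp hq => simp only [map_add, hp, hq]
  | mul_X p a' hp =>
    rw [map_mul, pderiv_mul, hp, pderiv_mul, map_add, map_mul, map_mul, aeval_X, pderiv_X]
    congr 1
    by_cases h : a' = a
    · subst h
      rw [ha]
      simp
    · have h0 : pderiv v ((d a').elim 0 X : MvPolynomial σ K) = 0 := by
        cases h' : d a' with
        | none => simp
        | some v' =>
          have hne : v' ≠ v := fun hv => h (huniq a' (by rw [h', hv]))
          simp [pderiv_X, hne.symm]
      rw [h0, Pi.single_apply, if_neg h]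
      simp

/-- Iterated version of `pderiv_aeval_option_of_unique` along a list of variables with unique
preimages. [folklore] -/
theorem iterPDeriv_aeval_option (d : α → Option σ) (f : α → σ) (l : List α)
    (hf : ∀ a ∈ l, d a = some (f a)) (huniq : ∀ a ∈ l, ∀ a', d a' = some (f a) → a' = a)
    (p : MvPolynomial α K) :
    iterPDeriv (l.map f) (aeval (fun a => ((d a).elim 0 X : MvPolynomial σ K)) p) =
      aeval (fun a => ((d a).elim 0 X : MvPolynomial σ K)) (iterPDeriv l p) := by
  induction l with
  | nil => rfl
  | cons a l ih =>
    rw [List.map_cons, iterPDeriv_cons, iterPDeriv_cons,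
      ih (fun a ha => hf a (List.mem_cons_of_mem _ ha))
        (fun a ha => huniq a (List.mem_cons_of_mem _ ha)),
      pderiv_aeval_option_of_unique d (hf a List.mem_cons_self) (huniq a List.mem_cons_self)]

omit [DecidableEq α] [DecidableEq σ] in
/-- Iterated derivatives commute with injective renamings (Mathlib's `pderiv_rename`). [folklore] -/
theorem iterPDeriv_rename {f : α → σ} (hf : Function.Injective f) (l : List α)
    (p : MvPolynomial α K) :
    iterPDeriv (l.map f) (rename f p) = rename f (iterPDeriv l p) := by
  induction l with
  | nil => rfl
  | cons a l ih => rw [List.map_cons, iterPDeriv_cons, iterPDeriv_cons, ih, pderiv_rename hf]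

end OptSubst

/-! ### Derivatives of products of polynomials in disjoint variables -/

section DisjointProduct

variable {K : Type*} [CommRing K] {σ : Type*}

/-- A partial derivative involves no new variables. [folklore] -/
theorem vars_pderiv_subset [DecidableEq σ] (i : σ) (p : MvPolynomial σ K) :
    (pderiv i p).vars ⊆ p.vars := by
  intro v hv
  rw [mem_vars_iff_mem_support] at hv ⊢
  obtain ⟨γ, hγ, hvγ⟩ := hv
  rw [mem_support_iff, coeff_pderiv] at hγ
  refine ⟨γ + Finsupp.single i 1, mem_support_iff.2 (left_ne_zero_of_mul hγ), ?_⟩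
  rw [Finsupp.mem_support_iff] at hvγ ⊢
  rw [Finsupp.add_apply]
  omega

/-- Iterated partial derivatives involve no new variables. [folklore] -/
theorem vars_iterPDeriv_subset [DecidableEq σ] (l : List σ) (p : MvPolynomial σ K) :
    (iterPDeriv l p).vars ⊆ p.vars := by
  induction l with
  | nil => exact subset_rfl
  | cons i l ih => rw [iterPDeriv_cons]; exact (vars_pderiv_subset i _).trans ih

/-- Leibniz with a constant factor: derivatives along variables not occurring in `F` pass `F`. [folklore] -/
theorem iterPDeriv_mul_left (l : List σ) (F G : MvPolynomial σ K) (h : ∀ v ∈ l, v ∉ F.vars) :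
    iterPDeriv l (F * G) = F * iterPDeriv l G := by
  classical
  induction l with
  | nil => rfl
  | cons v l ih =>
    rw [iterPDeriv_cons, iterPDeriv_cons, ih fun w hw => h w (List.mem_cons_of_mem _ hw), pderiv_mul,
      pderiv_eq_zero_of_notMem_vars (h v List.mem_cons_self), zero_mul, zero_add]

/-- Leibniz with a constant factor on the right. [folklore] -/
theorem iterPDeriv_mul_right (l : List σ) (F G : MvPolynomial σ K) (h : ∀ v ∈ l, v ∉ G.vars) :
    iterPDeriv l (F * G) = iterPDeriv l F * G := by
  rw [mul_comm, iterPDeriv_mul_left l G F h, mul_comm]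

/-- A variable of a product occurs in some factor. [folklore] -/
theorem exists_mem_vars_of_mem_vars_list_prod [DecidableEq σ] (l : List (MvPolynomial σ K)) {v : σ}
    (hv : v ∈ l.prod.vars) : ∃ p ∈ l, v ∈ p.vars := by
  induction l with
  | nil =>
    rw [List.prod_nil, ← C_1, vars_C] at hv
    exact (Finset.notMem_empty _ hv).elim
  | cons p l ih =>
    rw [List.prod_cons] at hv
    rcases Finset.mem_union.1 (vars_mul _ _ hv) with h | h
    · exact ⟨p, List.mem_cons_self, h⟩
    · obtain ⟨q, hq, hvq⟩ := ih h
      exact ⟨q, List.mem_cons_of_mem _ hq, hvq⟩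

/-- Derivatives along a concatenated list. [folklore] -/
theorem iterPDeriv_append (l₁ l₂ : List σ) (p : MvPolynomial σ K) :
    iterPDeriv (l₁ ++ l₂) p = iterPDeriv l₁ (iterPDeriv l₂ p) := by
  simp [iterPDeriv, List.foldr_append]

/-- **Leibniz for disjoint variables**: for factors `F i` in pairwise disjoint sets of variables
and per-factor derivative lists `L i` (the variables of `L i` occurring in no other factor), the
derivative of `∏ F i` along the concatenation of the `L i` is `∏ (∂_{L i} F i)` — the mechanism of
ELSW Example 3.1. [folklore] -/
theorem iterPDeriv_list_prod {ι : Type*} (idx : List ι) (hnd : idx.Nodup) (F : ι → MvPolynomial σ K)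
    (L : ι → List σ) (h : ∀ i ∈ idx, ∀ j ∈ idx, i ≠ j → ∀ v ∈ L i, v ∉ (F j).vars) :
    iterPDeriv (idx.flatMap L) (idx.map F).prod = (idx.map fun i => iterPDeriv (L i) (F i)).prod := by
  classical
  induction idx with
  | nil => rfl
  | cons i idx ih =>
    have hi : i ∉ idx := (List.nodup_cons.1 hnd).1
    have hnd' : idx.Nodup := (List.nodup_cons.1 hnd).2
    rw [List.flatMap_cons, List.map_cons, List.prod_cons, List.map_cons, List.prod_cons,
      iterPDeriv_append]
    have ih' := ih hnd' fun i' hi' j hj hne => h i' (List.mem_cons_of_mem _ hi') j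
      (List.mem_cons_of_mem _ hj) hne
    have h1 : ∀ v ∈ idx.flatMap L, v ∉ (F i).vars := by
      intro v hv
      obtain ⟨j, hj, hvj⟩ := List.mem_flatMap.1 hv
      exact h j (List.mem_cons_of_mem _ hj) i List.mem_cons_self (fun hji => hi (hji ▸ hj)) v hvj
    rw [iterPDeriv_mul_left _ _ _ h1, ih']
    have h2 : ∀ v ∈ L i, v ∉ ((idx.map fun j => iterPDeriv (L j) (F j)).prod).vars := by
      intro v hv hmem
      obtain ⟨q, hq, hvq⟩ := exists_mem_vars_of_mem_vars_list_prod _ hmem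
      obtain ⟨j, hj, rfl⟩ := List.mem_map.1 hq
      exact h i List.mem_cons_self j (List.mem_cons_of_mem _ hj) (fun hij => hi (hij ▸ hj)) v hv
        (vars_iterPDeriv_subset _ _ hvq)
    rw [iterPDeriv_mul_right _ _ _ h2]

end DisjointProduct

/-! ### The derivative of the generic determinant along a rook complement -/

section GenericBlock

variable {K : Type*} [CommRing K] {c : ℕ}

/-- **Derivative of the generic determinant along a rook complement**: differentiating `det_c`
along the `c - 1` cells `(π₀ b, b)`, `b ≠ b₀`, of the transversal of a permutation `π₀` leaves
`sign π₀ · X (π₀ b₀, b₀)` (the only permutation through these cells is `π₀`; cf. ELSW Example 3.1).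
[cite: EfremenkoLandsbergSchenckWeyman2018, §3 (Example 3.1)] -/
theorem iterPDeriv_rook_detPoly (π₀ : Equiv.Perm (Fin c)) (b₀ : Fin c) :
    iterPDeriv (((Finset.univ.erase b₀).toList).map (grEmb π₀))
        (Literature.Computability.AlgebraicComplexity.detPoly (Fin c) K) =
      ((Equiv.Perm.sign π₀ : ℤ) : K) • X (π₀ b₀, b₀) := by
  classical
  rw [detPoly_eq_permSum,
    iterPDeriv_permSum _ π₀ (Finset.univ.erase b₀) _
      ((Finset.nodup_toList _).map (grEmb π₀).injective)
      (by ext v; simp only [List.mem_toFinset, List.mem_map, Finset.mem_map, Finset.mem_toList])]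
  rw [canon]
  have hfilter : (Finset.univ.filter fun π : Equiv.Perm (Fin c) =>
      ∀ b ∈ Finset.univ.erase b₀, π b = π₀ b) = {π₀} := by
    ext π
    simp only [Finset.mem_filter, Finset.mem_univ, true_and, Finset.mem_singleton,
      Finset.mem_erase, ne_eq, and_true]
    constructor
    · intro h
      refine Equiv.ext fun b => ?_
      by_cases hb : b = b₀
      · subst hb
        have hx : π₀.symm (π b) = b := by
          by_contra hx
          have h2 := h _ hx
          rw [Equiv.apply_symm_apply] at h2
          exact hx (π.injective h2)
        have := congrArg π₀ hx
        rw [Equiv.apply_symm_apply] at this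
        exact this
      · exact h b hb
    · rintro rfl b _; rfl
  rw [hfilter, Finset.sum_singleton]
  have hoff : offGraph π₀ (Finset.univ.erase b₀) = {(π₀ b₀, b₀)} := by
    ext v
    rw [mem_offGraph, Finset.mem_singleton, Finset.mem_erase]
    constructor
    · rintro ⟨h1, h2⟩
      have hv2 : v.2 = b₀ := by
        by_contra h; exact h1 ⟨h, Finset.mem_univ _⟩
      exact Prod.ext (by rw [← h2, hv2]) hv2
    · rintro rfl
      exact ⟨fun h => h.1 rfl, rfl⟩
  rw [hoff, sqfree, Finset.sum_singleton, MvPolynomial.smul_eq_C_mul, X, C_mul_monomial, mul_one]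

/-- The rook complement has `c - 1` cells. [folklore] -/
theorem length_rook (π₀ : Equiv.Perm (Fin c)) (b₀ : Fin c) :
    (((Finset.univ.erase b₀).toList).map (grEmb π₀)).length = c - 1 := by
  rw [List.length_map, Finset.length_toList, Finset.card_erase_of_mem (Finset.mem_univ _),
    Finset.card_univ, Fintype.card_fin]

/-- Membership in the rook complement list. [folklore] -/
theorem mem_rook {π₀ : Equiv.Perm (Fin c)} {b₀ : Fin c} {v : Fin c × Fin c} :
    v ∈ ((Finset.univ.erase b₀).toList).map (grEmb π₀) ↔ v.2 ≠ b₀ ∧ v.1 = π₀ v.2 := by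
  rw [List.mem_map]
  constructor
  · rintro ⟨b, hb, rfl⟩
    rw [Finset.mem_toList, Finset.mem_erase] at hb
    exact ⟨hb.1, rfl⟩
  · rintro ⟨h1, h2⟩
    refine ⟨v.2, ?_, Prod.ext h2.symm rfl⟩
    rw [Finset.mem_toList, Finset.mem_erase]
    exact ⟨h1, Finset.mem_univ _⟩

/-- **Tridiagonal matchings.** For any `i, j` there is a permutation `π` of `Fin c` with `π j = i`
all of whose other cells `(π b, b)`, `b ≠ j`, are tridiagonal (`b = π b`, `b = π b + 1` or
`π b = b + 1`): shift the interval between `i` and `j` by one, fix the rest. [folklore] -/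
theorem exists_tridiagonal_matching (i j : Fin c) :
    ∃ π : Equiv.Perm (Fin c), π j = i ∧ ∀ b : Fin c, b ≠ j →
      (b.val = (π b).val ∨ b.val = (π b).val + 1 ∨ (π b).val = b.val + 1) := by
  -- the matching, on values
  let f : ℕ → ℕ := fun b => if b = j.val then i.val else
    if b < min i.val j.val ∨ max i.val j.val < b then b else if i.val < j.val then b + 1 else b - 1
  have hf_lt : ∀ b : ℕ, b < c → f b < c := by
    intro b hb
    have := i.2; have := j.2
    simp only [f]
    split_ifs <;> omega
  let g : Fin c → Fin c := fun b => ⟨f b.val, hf_lt b.val b.2⟩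
  have hg_inj : Function.Injective g := by
    intro b b' h
    apply Fin.ext
    have h' : f b.val = f b'.val := congrArg Fin.val h
    have := i.2; have := j.2; have := b.2; have := b'.2
    simp only [f] at h'
    split_ifs at h' <;> omega
  refine ⟨Equiv.ofBijective g (Finite.injective_iff_bijective.1 hg_inj), ?_, ?_⟩
  · apply Fin.ext
    change f j.val = i.val
    simp [f]
  · intro b hb
    have hbv : b.val ≠ j.val := fun h => hb (Fin.ext h)
    change b.val = f b.val ∨ b.val = f b.val + 1 ∨ f b.val = b.val + 1
    have := i.2; have := j.2; have := b.2
    simp only [f]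
    split_ifs <;> omega

end GenericBlock

/-! ### Supports, degrees and monomial counts -/

section Support

variable {K : Type*} [Field K] {σ : Type*}

/-- Partial derivatives of forms of degree `e` are forms of degree `e - 1`. [folklore] -/
theorem isHomogeneous_pderiv [DecidableEq σ] {p : MvPolynomial σ K} {e : ℕ} (hp : p.IsHomogeneous e)
    (i : σ) : (pderiv i p).IsHomogeneous (e - 1) := by
  intro γ hγ
  rw [coeff_pderiv] at hγ
  have h1 := hp (left_ne_zero_of_mul hγ)
  have hw : Finsupp.weight (1 : σ → ℕ) (Finsupp.single i 1) = 1 := by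
    simp [Finsupp.weight_single]
  rw [map_add, hw] at h1
  change Finsupp.weight 1 γ = e - 1
  omega

/-- Iterated partial derivatives of forms are forms. [folklore] -/
theorem isHomogeneous_iterPDeriv [DecidableEq σ] {p : MvPolynomial σ K} {e : ℕ}
    (hp : p.IsHomogeneous e) (l : List σ) : (iterPDeriv l p).IsHomogeneous (e - l.length) := by
  induction l with
  | nil => simpa using hp
  | cons i l ih =>
    rw [iterPDeriv_cons, List.length_cons]
    have := isHomogeneous_pderiv ih i
    rwa [Nat.sub_sub] at this

/-- The support of `x^β · w` for a form `w` of degree `d` in the variables `Z`: every monomial has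
degree `|β| + d` and `Z`-degree at least `d` (the shape of ELSW's inclusions
`I^{P,k}_{n-k+τ} ⊂ S^τ · S^{n-k}ℂ^{m²+1}`, §3). [folklore] -/
theorem support_monomial_mul_subset [DecidableEq σ] (Z : Finset σ) {w : MvPolynomial σ K} {d : ℕ}
    (hw : w.IsHomogeneous d) (hZ : w.vars ⊆ Z) (β : σ →₀ ℕ) {μ : σ →₀ ℕ}
    (hμ : μ ∈ (monomial β (1 : K) * w).support) :
    μ.degree = β.degree + d ∧ d ≤ ∑ v ∈ Z, μ v := by
  rw [mem_support_iff, coeff_monomial_mul'] at hμ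
  split_ifs at hμ with hle
  · rw [one_mul] at hμ
    have hγ : (μ - β) ∈ w.support := mem_support_iff.2 hμ
    have hdeg : (μ - β).degree = d := by
      have := hw hμ
      rwa [Finsupp.degree_eq_weight_one]
    have hsupp : (μ - β).support ⊆ Z := fun v hv =>
      hZ ((mem_vars_iff_mem_support _).2 ⟨_, hγ, hv⟩)
    constructor
    · have : μ = β + (μ - β) := (add_tsub_cancel_of_le hle).symm
      rw [this, map_add, hdeg]
    · calc d = (μ - β).degree := hdeg.symm
        _ = ∑ v ∈ (μ - β).support, (μ - β) v := Finsupp.degree_apply _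
        _ ≤ ∑ v ∈ Z, (μ - β) v := Finset.sum_le_sum_of_subset hsupp
        _ ≤ ∑ v ∈ Z, μ v := Finset.sum_le_sum fun v _ => by
            rw [Finsupp.tsub_apply]; exact Nat.sub_le _ _
  · exact (hμ rfl).elim

/-- The polynomials supported on a finite set `T` of monomials form a space of dimension `#T`
(Mathlib's monomial basis `basisRestrictSupport`). [folklore] -/
theorem finrank_restrictSupport (T : Finset (σ →₀ ℕ)) :
    Module.finrank K (restrictSupport K (↑T : Set (σ →₀ ℕ))) = T.card := by
  rw [Module.finrank_eq_card_basis (basisRestrictSupport K (↑T : Set (σ →₀ ℕ)))]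
  exact Fintype.card_coe T

/-- ... which is finite-dimensional (use with `haveI`). [folklore] -/
theorem finite_restrictSupport (T : Finset (σ →₀ ℕ)) :
    Module.Finite K (restrictSupport K (↑T : Set (σ →₀ ℕ))) :=
  Module.Finite.of_basis (basisRestrictSupport K (↑T : Set (σ →₀ ℕ)))

/-- Greedy choice: below a monomial of `Z`-degree `≥ s` there is a product of `s` variables of `Z`. [folklore] -/
theorem exists_fun_sum_single_le (Z : Finset σ) (s : ℕ) :
    ∀ μ : σ →₀ ℕ, s ≤ ∑ v ∈ Z, μ v →
      ∃ q : Fin s → σ, (∀ t, q t ∈ Z) ∧ (∑ t, Finsupp.single (q t) 1) ≤ μ := by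
  classical
  induction s with
  | zero => intro μ _; exact ⟨Fin.elim0, fun t => t.elim0, by simp⟩
  | succ s ih =>
    intro μ hμ
    -- some `v₀ ∈ Z` has `μ v₀ ≥ 1`
    have hex : ∃ v₀ ∈ Z, 1 ≤ μ v₀ := by
      by_contra hno
      push Not at hno
      have : ∑ v ∈ Z, μ v = 0 := Finset.sum_eq_zero fun v hv => by have := hno v hv; omega
      omega
    obtain ⟨v₀, hv₀, h1⟩ := hex
    have hle : Finsupp.single v₀ 1 ≤ μ := by
      intro v
      rw [Finsupp.single_apply]
      split_ifs with h
      · subst h; exact h1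
      · exact Nat.zero_le _
    obtain ⟨q, hq, hsum⟩ := ih (μ - Finsupp.single v₀ 1) (by
      have hone : ∑ v ∈ Z, (Finsupp.single v₀ 1 : σ →₀ ℕ) v = 1 := by
        rw [Finset.sum_eq_single_of_mem v₀ hv₀ (fun v _ hne => by
          rw [Finsupp.single_apply, if_neg (Ne.symm hne)])]
        exact Finsupp.single_eq_same
      have hsplit : ∑ v ∈ Z, μ v = ∑ v ∈ Z, (μ - Finsupp.single v₀ 1 : σ →₀ ℕ) v + 1 := by
        have : ∀ v ∈ Z, μ v =
            (μ - Finsupp.single v₀ 1 : σ →₀ ℕ) v + (Finsupp.single v₀ 1 : σ →₀ ℕ) v := by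
          intro v _
          rw [Finsupp.tsub_apply, Nat.sub_add_cancel (hle v)]
        rw [Finset.sum_congr rfl this, Finset.sum_add_distrib, hone]
      omega)
    refine ⟨Fin.cons v₀ q, fun t => ?_, ?_⟩
    · rcases Fin.eq_zero_or_eq_succ t with rfl | ⟨t', rfl⟩
      · rw [Fin.cons_zero]; exact hv₀
      · rw [Fin.cons_succ]; exact hq t'
    · rw [Fin.sum_univ_succ]
      simp only [Fin.cons_zero, Fin.cons_succ]
      have h2 : Finsupp.single v₀ 1 + ∑ t, Finsupp.single (q t) 1 ≤
          Finsupp.single v₀ 1 + (μ - Finsupp.single v₀ 1) := fun v => by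
        simp only [Finsupp.add_apply]
        exact Nat.add_le_add_left (hsum v) _
      exact h2.trans (add_tsub_cancel_of_le hle).le

end Support

end Literature.Barriers.ValiantsHypothesis
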